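import Mathlib
import HarnessLib
import Summits.NavierStokesRegularity.NavierStokesRegularity.Theorems.ThreadingFluxHorizonTowerDefs
import Summits.NavierStokesRegularity.NavierStokesRegularity.Theorems.ThreadingFluxHorizonTowerDipoleTowerOrderOne

/-!
# Crux `PoloidalLiouville` (stmt-NavierStokesRegularity-1222, wall W1), crux idea «horizon-threading-tower» (ns-idea-15):
# `DipoleTowerHorizonZonality` BY NAME

ARM A (ns-exp-scalarLiouville g6), director KEY 2026-08-29T05:03:18Z (2): the Prop `HorizonTower.DipoleTowerHorizonZonality` of the
Defs twin (`Theorems/ThreadingFluxHorizonTowerDefs.lean`, appended 2026-08-29) is inhabited by pure term application of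
`dipoleTowerHorizonZonality_of` (`Theorems/ThreadingFluxHorizonTowerDipoleTowerOrderOne.lean`): «dipole towers `{1, m, n}`, `2 ≤ m ≠ n`,
`m, n` not both odd, are decided at order one» — a scale-free three-shell tower of horizon profiles with one dipole shell, annihilated by
`𝔏₁` off the centre, is coaxially zonal.

HONEST LABEL / BOOKING: ★★ special-case theorem of the crux-IDEA conjecture `HorizonTowerZonality` (2); `HorizonTowerZonality`,
`PoloidalLiouville` (1222), W1 and NS regularity are OPEN / NOT proved (W1 movement 0); no NS statement.
`--supports stmt-NavierStokesRegularity-1222 --as helper`.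
-/

-- the summit and its single sub-problem share the name (CONVENTIONS §1)
set_option linter.dupNamespace false

noncomputable section

namespace Summit.NavierStokesRegularity.NavierStokesRegularity.Theorems.PoloidalLiouville.HorizonTower

/-- ★★ **DIPOLE TOWERS `{1, m, n}` (`m, n` not both odd) ARE DECIDED AT ORDER ONE** — the Defs-twin Prop `DipoleTowerHorizonZonality`
by name. -/
theorem dipoleTowerHorizonZonality : DipoleTowerHorizonZonality := dipoleTowerHorizonZonality_of

end Summit.NavierStokesRegularity.NavierStokesRegularity.Theorems.PoloidalLiouville.HorizonTower

end
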